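import Summits.HubbardSuperconductivity.HubbardLadder.HeisenbergPlusAntipodalRowTorus
import Literature.MathematicalPhysics.QuantumLattice.SpinEmbedding
import Literature.MathematicalPhysics.QuantumLattice.MatrixProductStatesProofs

/-!
# Cluster pair-cut rows in the torus ground state (generic transfer theorem; pieces [A] + [R] of the cluster pair-cut road; no new definitions)

HONEST FRAMING: ladder R1–R4 with certified numbers; no claim on H/H₀.

Staged in the pub-hubbard cell (r2 g43 `planner-pub-hubbard-r2-g43-0`, 2026-08-27; spec memo
`CLUSTER-ROW-SPEC-g43.md` v2 §1–§2); filed only on a desk GO by a FILER seat.  Infrastructure: it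
certifies no cell by itself — the instance-specific input is the cluster certificate `hpsd`.

THE TRANSFER.  A *cluster pair-cut* is an operator inequality on `N` spin-½ sites,
`X_C - σ·1 ⪰ 0` with `X_C = Σ_{i,j} w_{ij} 𝐒_i·𝐒_j` (any state; `w_{ii} = 0`).  Placing the cluster in
the `L × L` torus by a window table `site : Fin N → ℕ × ℕ` with coordinates `< L` (injective), the
second-quantised site injection `spinEmbed` (Bratteli–Robinson II §6.2.1) carries the inequality to
the torus algebra (`posSemidef_spinEmbed`, [A]); positivity of the tracial ground-state functional of
the Heisenberg antiferromagnet (`Matrix.groundStateFunctional_nonneg_of_posSemidef`) and the window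
dictionary `PlusAntipodal.re_gsf_wpt` (`Re ω(𝐒_p·𝐒_q) = 3 c_L(|Δx|, |Δy|)`) then give the ROW
  `σ ≤ Σ_{i,j} w_{ij} · 3 c_L(|x_i - x_j|, |y_i - y_j|)`        (`clusterCutRow_window`, [R])
for every `L` exceeding the window coordinates — uniformly in `L`, which is what the `NeelSign*`
L-uniform certificates consume (house pattern: `PlusAntipodal.heis_plusRow_window`).

What is NOT here: the cluster certificate itself (`hpsd`; per cut, pieces [C] + [D]
`ClusterCut.posSemidef_sub_smul_of_weightZero_spinHalf`), and the collection of the double sum into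
displacement classes (per cut, one `norm_num`).
-/

noncomputable section

open Matrix Complex Finset
open scoped ComplexOrder

namespace Summit.HubbardSuperconductivity.HubbardLadder.ClusterCut

open Literature.MathematicalPhysics.QuantumLattice Literature.Probability.LatticeModels
open Summit.HubbardSuperconductivity.HubbardLadder.PlusAntipodal

/-! ### [A] positivity is preserved by the site-injection embedding -/

section Embed

variable {X Y : Type*} [Fintype X] [DecidableEq X] [Fintype Y] [DecidableEq Y] {q : ℕ}

/-- **`spinEmbed` preserves positive semidefiniteness**: `A ⪰ 0 ⟹ Γ_φ A = (A relabelled) ⊗ 𝟙 ⪰ 0`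
(`spinEmbed_eq_localOp`, `posSemidef_localOp`, and relabelling = `submatrix` along an equivalence).
Bratteli–Robinson II §6.2.1. [folklore] -/
theorem posSemidef_spinEmbed (φ : X ↪ Y) {A : Op X q} (hA : A.PosSemidef) :
    (spinEmbed φ A).PosSemidef := by
  have h : reindexOp (rangeEquiv φ) A =
      A.submatrix (fun σ => fun x => σ (rangeEquiv φ x)) (fun σ => fun x => σ (rangeEquiv φ x)) :=
    Matrix.ext fun _ _ => rfl
  rw [spinEmbed_eq_localOp, h]
  exact posSemidef_localOp _ (hA.submatrix _)

end Embed

/-! ### [R] the row a cluster pair-cut yields in the torus ground state -/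

section Row

/-- **Cluster pair-cut row (generic transfer theorem).** If on `N` spin-½ sites
`Σ_{i,j} w_{ij} 𝐒_i·𝐒_j - σ·1 ⪰ 0` (with `w_{ii} = 0`), and the sites are placed in the `L × L`
torus at window points `site i` with coordinates `< L` (injectively), then in the ground state of
the spin-½ Heisenberg antiferromagnet
`σ ≤ Σ_{i,j} w_{ij} · 3 c_L(|x_i - x_j|, |y_i - y_j|)` where `c_L(a,b) = heisRedCorr2 L 1 a b`.
Uniform in `L`; the instance-specific input is `hpsd`. House pattern
`PlusAntipodal.heis_plusRow_window`; Bratteli–Robinson II §6.2.1; Tasaki (2020) §2.5. [folklore] -/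
theorem clusterCutRow_window (L : ℕ) [NeZero L] {N : ℕ} (site : Fin N → ℕ × ℕ)
    (hsite : ∀ i, (site i).1 < L ∧ (site i).2 < L) (hinj : Function.Injective site)
    (w : Fin N → Fin N → ℝ) (hw : ∀ i, w i i = 0) (σ : ℝ)
    (hpsd : ((∑ i, ∑ j, (w i j : ℂ) • spinDot 1 i j : Op (Fin N) 2) -
      (σ : ℂ) • (1 : Op (Fin N) 2)).PosSemidef) :
    σ ≤ ∑ i, ∑ j, w i j * (3 * heisRedCorr2 L 1 (((site i).1 : ℤ) - (site j).1).natAbs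
      (((site i).2 : ℤ) - (site j).2).natAbs) := by
  classical
  -- the window embedding `i ↦ (x_i mod L, y_i mod L)` (injective: `PlusAntipodal.wpt_inj`)
  let φ : Fin N ↪ TorusSite 2 L :=
    ⟨fun i => wpt L (site i), fun i j h => hinj (wpt_inj L (hsite i) (hsite j) h)⟩
  have hφ : ∀ i, φ i = wpt L (site i) := fun _ => rfl
  haveI : Nonempty (TorusSite 2 L) := ⟨wpt L (0, 0)⟩
  -- [A]: transport the cluster inequality to the torus algebra
  have hE := posSemidef_spinEmbed φ hpsd
  rw [map_sub, map_smul, map_one, map_sum] at hE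
  simp_rw [map_sum, map_smul, spinEmbed_spinDot, hφ] at hE
  -- positivity of the ground-state functional
  have h0 := groundStateFunctional_nonneg_of_posSemidef (heisenbergTorus 2 L 1 1) hE
  have hω1 : (heisenbergTorus 2 L 1 1).groundStateFunctional 1 = 1 :=
    groundStateFunctional_one (heisenbergTorus_isHermitian 2 L 1 1)
  rw [map_sub, map_smul, hω1, map_sum] at h0
  simp_rw [map_sum, map_smul, smul_eq_mul, mul_one] at h0
  obtain ⟨hre, -⟩ := Complex.nonneg_iff.mp h0
  rw [Complex.sub_re, Complex.ofReal_re, Complex.re_sum] at hre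
  simp_rw [Complex.re_sum, Complex.re_ofReal_mul] at hre
  -- the window dictionary, pair by pair (diagonal terms carry weight 0)
  have hterm : ∀ i j, w i j * ((heisenbergTorus 2 L 1 1).groundStateFunctional
      (spinDot 1 (wpt L (site i)) (wpt L (site j)))).re = w i j * (3 * heisRedCorr2 L 1
      (((site i).1 : ℤ) - (site j).1).natAbs (((site i).2 : ℤ) - (site j).2).natAbs) := by
    intro i j
    by_cases hij : i = j
    · subst hij
      rw [hw, zero_mul, zero_mul]
    · have hne : wpt L (site i) ≠ wpt L (site j) :=
        fun h => hij (hinj (wpt_inj L (hsite i) (hsite j) h))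
      rw [re_gsf_wpt L hne _ _ rfl rfl]
  simp_rw [hterm] at hre
  linarith

end Row

end Summit.HubbardSuperconductivity.HubbardLadder.ClusterCut

end
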